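import Mathlib

/-!
# Shape packing for ordered escape ladders — sharp elementary form (siege k22)

Support file for item `stmt-MatrixMultiplication-14308` (`FourierTwoFamiliesModP.PrimeTwoFamilies`,
CKSU 2005 Conj. 4.7 with prime cyclic hosts), line Sketch, registered stub
`ladder_sum_card_mul_card_le_of_subshape` (siege k22, variation "explicit / elementary route").

A LADDER in an abelian group `G` is a family of `r` classes `(X c, Y c)`, `c : Fin r`, with

* (`hW`) every class direct: `(x - x') + (y - y') = 0` with `x, x' ∈ X c`, `y, y' ∈ Y c` forces
  `x = x'` and `y = y'`;
* (`hL`) for classes `p < q` every cross difference `y' - x'` (`x' ∈ X p`, `y' ∈ Y q`) avoids every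
  diagonal difference `y - x` (`x ∈ X c`, `y ∈ Y c`, ANY class `c`).

The registered stub (a common translated sub-pattern `u c +ᵥ Y₀ ⊆ Y c`, `c ∈ S`, packs:
`(Σ_{c ∈ S} |X c|) · |Y₀| ≤ |G|`) already has a proof in the tree
(`…Theorems.PrimeTwoFamilies.LadderLift.ladder_sum_card_mul_card_le_of_subshape`).  What this file
adds is the SHARP form of that packing engine, which the explicit proof below makes visible, and
from which the registered stub is a three-line specialisation:

`ladder_sum_card_mul_card_le_of_nestedSubshapes` — two strengthenings at once.

1. ONLY THE RIGHT-ANCHORED HALF OF THE LADDER AXIOM IS USED: the hypothesis is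
   `hR : ∀ p < q, (Y q - X q) ∩ (Y q - X p) = ∅` (diagonal differences of the UPPER class against
   cross differences INTO the upper class), i.e. `hL` at `c = q` only.  The clauses of `hL` with
   `c ≠ q` — in particular the whole left-anchored half `c = p` — are idle for shape packing, so the
   design rule "near-apex ladders need many pairwise non-translate `Y`-sides" constrains the larger
   class of right-anchored ladders as well.
2. THE PATTERNS MAY GROW ALONG THE ORDER: if class `q` carries, at ONE offset `u q`, the patterns of
   all classes `p ≤ q` of `S` (`u q +ᵥ Y₀ p ⊆ Y q`), then `Σ_{c ∈ S} |X c| · |Y₀ c| ≤ |G|`.  For a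
   constant pattern this is the stub; for cumulative ("staircase") menus `Y₀ 0 ⊆ Y₀ 1 ⊆ ⋯` it is
   strictly stronger than every instance of the one-pattern bound (e.g. `|G| = 100`, two classes
   with `|X 0| = 60, |Y₀ 0| = 1, |X 1| = 6, |Y₀ 1| = 10` pass both one-pattern tests `66 ≤ 100`,
   `60 ≤ 100` but fail `60 + 60 ≤ 100`).

The proof is the explicit, first-principles one, in two steps.

* UNIQUENESS OF REPRESENTATION (`ladder_rep_unique`): a group element has at most one
  representation `g = x + y₀` with `c ∈ S`, `x ∈ X c`, `y₀ ∈ Y₀ c`.  Given two representations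
  `a + b = a' + b'` (`a ∈ X i`, `b ∈ Y₀ i`, `a' ∈ X k`, `b' ∈ Y₀ k`) one has, for every `v`, the
  explicit identities `(v + b) - a' = (v + b') - a` (1) and `(a - a') + ((v + b) - (v + b')) = 0`
  (2).  For `i < k`, (1) at `v = u k` makes a diagonal difference of class `k` equal to a cross
  difference from `X i × Y k`, against `hR i k`; `k < i` is symmetric (`hR k i`); for `i = k`, (2) at
  `v = u i` and directness of class `i` give `a = a'`, `b = b'`.
* DOUBLE COUNTING: the finite set of representations `(c, x, y₀)` has `Σ_{c ∈ S} |X c| · |Y₀ c|`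
  elements; sorted by the value `x + y₀ ∈ G`, every fibre holds at most one of them, so it has at
  most `|G|` elements (`Finset.card_eq_sum_card_fiberwise`, `Finset.card_le_one`).

Only `import Mathlib`.
-/

-- single-conjunct summit: the mandated namespace repeats `MatrixMultiplication` (summit = sub-problem).
set_option linter.dupNamespace false

namespace Summit.MatrixMultiplication.MatrixMultiplication.Theorems.PrimeTwoFamilies.LadderLift.SiegeK22

open Finset
open scoped Pointwise

/-- **Uniqueness of representation (right-anchored ladders, cumulative patterns).**  Let the
classes `(X c, Y c)_{c < r}` be direct (`hW`) and right-anchored (`hR`: for `p < q`, diagonal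
differences `y - x` of class `q` avoid the cross differences `y' - x'`, `x' ∈ X p`, `y' ∈ Y q`),
and let class `q ∈ S` carry at one offset `u q` the patterns of all classes `p ≤ q` of `S`
(`hY : u q +ᵥ Y₀ p ⊆ Y q`).  If `a + b = a' + b'` with `a ∈ X i`, `b ∈ Y₀ i`, `a' ∈ X k`,
`b' ∈ Y₀ k` (`i, k ∈ S`), then `i = k`, `a = a'` and `b = b'`.

Proof: the collision gives, for every `v`, the explicit identities
`(v + b) - a' = (v + b') - a` (1) and `(a - a') + ((v + b) - (v + b')) = 0` (2).  For `i < k`,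
(1) at `v = u k` makes the diagonal difference `(u k + b) - a'` of class `k` equal to the cross
difference `(u k + b') - a` from `X i × Y k`, against `hR i k`; the case `k < i` is symmetric
(`hR k i`); for `i = k`, (2) at `v = u i` and directness of class `i` give `a = a'` and
`u i + b = u i + b'`. -/
theorem ladder_rep_unique {G : Type*} [AddCommGroup G] [DecidableEq G] {r : ℕ}
    (X Y : Fin r → Finset G)
    (hW : ∀ c : Fin r, ∀ x ∈ X c, ∀ x' ∈ X c, ∀ y ∈ Y c, ∀ y' ∈ Y c,
      (x - x') + (y - y') = 0 → x = x' ∧ y = y')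
    (hR : ∀ p q : Fin r, p < q → ∀ x ∈ X q, ∀ y ∈ Y q, ∀ x' ∈ X p, ∀ y' ∈ Y q, y - x ≠ y' - x')
    (S : Finset (Fin r)) (Y₀ : Fin r → Finset G) (u : Fin r → G)
    (hY : ∀ p ∈ S, ∀ q ∈ S, p ≤ q → u q +ᵥ Y₀ p ⊆ Y q)
    {i k : Fin r} (hi : i ∈ S) (hk : k ∈ S) {a a' b b' : G} (ha : a ∈ X i) (ha' : a' ∈ X k)
    (hb : b ∈ Y₀ i) (hb' : b' ∈ Y₀ k) (h : a + b = a' + b') : i = k ∧ a = a' ∧ b = b' := by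
  -- the points of the translate `u q +ᵥ Y₀ p` are points of `Y q`
  have hmem : ∀ p ∈ S, ∀ q ∈ S, p ≤ q → ∀ y ∈ Y₀ p, u q + y ∈ Y q :=
    fun p hp q hq hpq y hy => hY p hp q hq hpq (Finset.vadd_mem_vadd_finset hy)
  -- explicit identity (1): the collision as an equality of translated differences
  have e₁ : ∀ v : G, (v + b) - a' = (v + b') - a := fun v => by
    rw [sub_eq_sub_iff_add_eq_add, add_assoc, add_assoc, add_comm b a, h, add_comm b' a']
  -- explicit identity (2): the collision as a vanishing sum of differences
  have e₂ : ∀ v : G, (a - a') + ((v + b) - (v + b')) = 0 := fun v => by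
    rw [add_sub_add_left_eq_sub, sub_add_sub_comm, h, sub_self]
  rcases lt_trichotomy i k with hik | rfl | hki
  · -- `i < k`: diagonal pair `(a', u k + b)` of class `k` against the cross pair `(a, u k + b')`
    exact absurd (e₁ (u k)) (hR i k hik a' ha' (u k + b) (hmem i hi k hk hik.le b hb) a ha
      (u k + b') (hmem k hk k hk le_rfl b' hb'))
  · -- `i = k`: directness of class `i`
    obtain ⟨h₁, h₂⟩ := hW i a ha a' ha' (u i + b) (hmem i hi i hi le_rfl b hb) (u i + b')
      (hmem i hi i hi le_rfl b' hb') (e₂ (u i))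
    exact ⟨rfl, h₁, add_left_cancel h₂⟩
  · -- `k < i`: diagonal pair `(a, u i + b')` of class `i` against the cross pair `(a', u i + b)`
    exact absurd (e₁ (u i)).symm (hR k i hki a ha (u i + b') (hmem k hk i hi hki.le b' hb') a' ha'
      (u i + b) (hmem i hi i hi le_rfl b hb))

/-- **Cumulative translated sub-patterns pack (right-anchored ladders)** — the sharp form of the
shape-packing engine.  Let the classes `(X c, Y c)_{c < r}` be direct (`hW`) and right-anchored
(`hR`: for `p < q`, diagonal differences of class `q` avoid the cross differences from
`X p × Y q` — the `c = q` clauses of the ladder axiom; the other clauses are not needed), and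
suppose class `q ∈ S` carries at one offset `u q` the patterns of all classes `p ≤ q` of `S`:
`u q +ᵥ Y₀ p ⊆ Y q`.  Then `Σ_{c ∈ S} |X c| · |Y₀ c| ≤ |G|`.

Proof (double counting): the finite set of representations `(c, (x, y₀))`, `c ∈ S`, `x ∈ X c`,
`y₀ ∈ Y₀ c`, has `Σ_{c ∈ S} |X c| · |Y₀ c|` elements, and sorted by the value `x + y₀` each of the
`|G|` fibres holds at most one of them (`ladder_rep_unique`). -/
theorem ladder_sum_card_mul_card_le_of_nestedSubshapes {G : Type*} [AddCommGroup G] [Fintype G]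
    [DecidableEq G] {r : ℕ} (X Y : Fin r → Finset G)
    (hW : ∀ c : Fin r, ∀ x ∈ X c, ∀ x' ∈ X c, ∀ y ∈ Y c, ∀ y' ∈ Y c,
      (x - x') + (y - y') = 0 → x = x' ∧ y = y')
    (hR : ∀ p q : Fin r, p < q → ∀ x ∈ X q, ∀ y ∈ Y q, ∀ x' ∈ X p, ∀ y' ∈ Y q, y - x ≠ y' - x')
    (S : Finset (Fin r)) (Y₀ : Fin r → Finset G) (u : Fin r → G)
    (hY : ∀ p ∈ S, ∀ q ∈ S, p ≤ q → u q +ᵥ Y₀ p ⊆ Y q) :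
    ∑ c ∈ S, (X c).card * (Y₀ c).card ≤ Fintype.card G := by
  -- every fibre of the value map `(c, (x, y₀)) ↦ x + y₀` on the set of representations
  -- `S.sigma fun c => X c ×ˢ Y₀ c` holds at most one element
  have hfib : ∀ g : G, ((S.sigma fun c => X c ×ˢ Y₀ c).filter
      fun t : (Σ _ : Fin r, G × G) => t.2.1 + t.2.2 = g).card ≤ 1 := by
    intro g
    rw [Finset.card_le_one]
    rintro ⟨i, a, b⟩ ht ⟨k, a', b'⟩ ht'
    simp only [Finset.mem_filter, Finset.mem_sigma, Finset.mem_product] at ht ht'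
    obtain ⟨⟨hi, ha, hb⟩, hg⟩ := ht
    obtain ⟨⟨hk, ha', hb'⟩, hg'⟩ := ht'
    obtain ⟨rfl, rfl, rfl⟩ :=
      ladder_rep_unique X Y hW hR S Y₀ u hY hi hk ha ha' hb hb' (hg.trans hg'.symm)
    rfl
  -- double counting
  calc ∑ c ∈ S, (X c).card * (Y₀ c).card = (S.sigma fun c => X c ×ˢ Y₀ c).card := by
        rw [Finset.card_sigma]
        exact Finset.sum_congr rfl fun c _ => (Finset.card_product _ _).symm
    _ = ∑ g : G, ((S.sigma fun c => X c ×ˢ Y₀ c).filter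
          fun t : (Σ _ : Fin r, G × G) => t.2.1 + t.2.2 = g).card :=
        Finset.card_eq_sum_card_fiberwise fun _ _ => Finset.mem_univ _
    _ ≤ (Finset.univ : Finset G).card • 1 := Finset.sum_le_card_nsmul _ _ 1 fun g _ => hfib g
    _ = Fintype.card G := by rw [smul_eq_mul, mul_one, Finset.card_univ]

/-- **A common translated sub-pattern packs (ladders)** — registered stub
`ladder_sum_card_mul_card_le_of_subshape` of crux `stmt-MatrixMultiplication-14308` (line Sketch),
as the constant-pattern, full-ladder specialisation of
`ladder_sum_card_mul_card_le_of_nestedSubshapes`: if `(X c, Y c)_{c < r}` is a ladder (`hW`, `hL`)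
and `u c +ᵥ Y₀ ⊆ Y c` for every `c ∈ S`, then `(Σ_{c ∈ S} |X c|) · |Y₀| ≤ |G|`.  Only the clauses
`hL q p q` of the ladder axiom enter. -/
theorem ladder_sum_card_mul_card_le_of_subshape {G : Type*} [AddCommGroup G] [Fintype G]
    [DecidableEq G] {r : ℕ} (X Y : Fin r → Finset G)
    (hW : ∀ c : Fin r, ∀ x ∈ X c, ∀ x' ∈ X c, ∀ y ∈ Y c, ∀ y' ∈ Y c,
      (x - x') + (y - y') = 0 → x = x' ∧ y = y')
    (hL : ∀ c p q : Fin r, p < q → ∀ x ∈ X c, ∀ y ∈ Y c, ∀ x' ∈ X p, ∀ y' ∈ Y q, y - x ≠ y' - x')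
    (S : Finset (Fin r)) (Y₀ : Finset G) (u : Fin r → G) (hY : ∀ c ∈ S, u c +ᵥ Y₀ ⊆ Y c) :
    (∑ c ∈ S, (X c).card) * Y₀.card ≤ Fintype.card G := by
  rw [Finset.sum_mul]
  exact ladder_sum_card_mul_card_le_of_nestedSubshapes X Y hW (fun p q hpq => hL q p q hpq) S
    (fun _ => Y₀) u fun _ _ q hq _ => hY q hq

end Summit.MatrixMultiplication.MatrixMultiplication.Theorems.PrimeTwoFamilies.LadderLift.SiegeK22
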